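import Summits.Langlands.Langlands.Theses.SeedReachSplit

/-!
# Route SeedReachSplit — Assembly

The assembly item (stmt-Langlands-26676) of the child route `SeedReachSplit` (decomp-langlands lens-3 gen 15; refines the named-open-problem
crux FC = `SymmetricPowerAnchorSplit.CMSymmetricPowerAutomorphy`, stmt-Langlands-28219, of route-Langlands-SymmetricPowerAnchorSplit rev 1)
for the Langlands summit: `BaseChangeSeededSymPower → ThetaSeededSymPower → SeedIsolatedSymPower → SeedReachFrame → Langlands`.

This is literally the type of the route file's sorry-free deciding theorem `Summit.Langlands.Langlands.Theses.SeedReachSplit.closes`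
(FRAME″ reduces `Langlands` to Sym^{n-1} functoriality at a CM cohomological partner; two excluded middles on the reach dials
`BCReachable` / `ThetaReachable` dispatch to A, B or C).  Nothing here proves `Langlands`: the assembly records only that the four ledger
items of the route, taken together, imply the summit statement.
-/

set_option linter.dupNamespace false -- project-wide option (lakefile weak.linter.dupNamespace); `Summit.Langlands.Langlands` is the mandated namespace

namespace Summit.Langlands.Langlands.Theorems

/-- **Assembly of route SeedReachSplit** (stmt-Langlands-26676): `A → B → C → FRAME″ → Langlands`.  Proof: unfold `Assembly` and apply
the route's deciding theorem `Theses.SeedReachSplit.closes`. -/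
theorem seedReachSplit_assembly_proof :
    Summit.Langlands.Langlands.Theses.SeedReachSplit.Assembly := by
  unfold Summit.Langlands.Langlands.Theses.SeedReachSplit.Assembly
  exact Summit.Langlands.Langlands.Theses.SeedReachSplit.closes

end Summit.Langlands.Langlands.Theorems
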